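import Mathlib.Data.Real.Basic
import Mathlib.Data.Set.Finite.List
import Mathlib.Data.Fintype.Card
import Mathlib.Data.List.Nodup
import Mathlib.Data.Finset.Max
import Mathlib.Algebra.BigOperators.Pi
import Mathlib.Algebra.Order.BigOperators.Group.Finset
import Mathlib.Tactic.Linarith
import Mathlib.Tactic.Ring
import HarnessLib

/-!
# Potentials on a weighted digraph and non-negative closed walks (Gallai; Bellman–Ford)

Topic `Literature/Combinatorics/Optimization`, grouping namespace `DifferenceConstraints`. A
POTENTIAL for a digraph `E` on `V` with real arc weights `w` is a function `π : V → ℝ` with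
`π v ≤ π u + w u v` on every arc `E u v` (equivalently, a feasible solution of the system of
difference constraints `π v - π u ≤ w u v`). Classical characterisation (Gallai 1958; the
correctness argument of the Bellman–Ford shortest-path algorithm):

* `DifferenceConstraints.weight_nonneg_of_isPotential` — if a potential exists then every closed
  walk of `E` has non-negative weight (telescoping);
* `DifferenceConstraints.exists_isPotential` — on a finite vertex type, if every closed walk with
  at most `|V|` arcs has non-negative weight then a potential exists (`π v` = least weight of a
  walk with `< |V|` vertices… precisely: with at most `|V|` vertices, ending at `v`; a walk with one
  arc more repeats a vertex and splits off a closed walk of at most `|V|` arcs, which is dropped).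

Walks are vertex sequences (`List V`, consecutive vertices joined by arcs: `IsWalk`); `weight`
is the sum of the arc weights along the sequence; a closed walk has at least one arc and equal
end points (`IsClosedWalk`). Only walks of bounded length are needed in the hypothesis of the
existence theorem, which is the form used by linear-decision-tree arguments (the weight of such a
walk is an integer combination of the arc weights with multiplicities at most `|V|`: `mult`,
`weight_eq_sum_mult`, `mult_le_length`).

## References

* A. Schrijver, *Combinatorial Optimization — Polyhedra and Efficiency*, Springer 2003, Thm 8.2
  (a potential exists iff each directed circuit has non-negative length; attributed to Gallai
  1958) — the same statement; not in `references.bib`, cited here for attribution only.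
* T. H. Cormen, C. E. Leiserson, R. L. Rivest, C. Stein, *Introduction to Algorithms*, 3rd ed.,
  MIT Press 2009, §24.4, Thm 24.9 (difference constraints and negative-weight cycles) and
  Lemma 24.2 / Thm 24.4 (Bellman–Ford: shortest walks may be taken with `≤ |V| - 1` arcs).
  [CLRS2009]
-/

namespace Literature.Combinatorics.Optimization

namespace DifferenceConstraints

variable {V : Type*}

/-! ### Walks as vertex sequences, their weights -/

/-- `IsWalk E l`: consecutive vertices of the sequence `l` are joined by arcs of `E`.
[cite: CLRS2009, §24.4 (constraint graphs; paths and cycles as vertex sequences, §B.4)] -/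
def IsWalk (E : V → V → Prop) : List V → Prop
  | [] => True
  | [_] => True
  | u :: v :: l => E u v ∧ IsWalk E (v :: l)

/-- The weight (length) of a vertex sequence: the sum of `w` over its consecutive pairs.
[cite: CLRS2009, §24.4 (weight of a path/cycle)] -/
def weight (w : V → V → ℝ) : List V → ℝ
  | [] => 0
  | [_] => 0
  | u :: v :: l => w u v + weight w (v :: l)

/-- A closed walk: a walk with at least one arc whose first and last vertices coincide.
[cite: CLRS2009, §B.4 and §24.4 (cycles)] -/
def IsClosedWalk (E : V → V → Prop) (l : List V) : Prop :=
  IsWalk E l ∧ 2 ≤ l.length ∧ l.head? = l.getLast?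

/-- A potential for `(E, w)`: `π v ≤ π u + w u v` on every arc (a feasible solution of the
difference constraints `π v - π u ≤ w u v`). [cite: CLRS2009, §24.4 (feasible solutions of difference constraints) and §24.5 (triangle inequality)] -/
def IsPotential (E : V → V → Prop) (w : V → V → ℝ) (π : V → ℝ) : Prop :=
  ∀ u v, E u v → π v ≤ π u + w u v

section Algebra

variable (E : V → V → Prop) (w : V → V → ℝ)

/-- `IsWalk` on `u :: v :: l` (definitional unfolding). [folklore] -/
@[simp] theorem isWalk_cons_cons (u v : V) (l : List V) :
    IsWalk E (u :: v :: l) ↔ E u v ∧ IsWalk E (v :: l) := Iff.rfl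

/-- `IsWalk` on a singleton (definitional unfolding). [folklore] -/
@[simp] theorem isWalk_singleton (u : V) : IsWalk E [u] := trivial

/-- `IsWalk` on the empty sequence (definitional unfolding). [folklore] -/
@[simp] theorem isWalk_nil : IsWalk E ([] : List V) := trivial

/-- `weight` on `u :: v :: l` (definitional unfolding). [folklore] -/
@[simp] theorem weight_cons_cons (u v : V) (l : List V) :
    weight w (u :: v :: l) = w u v + weight w (v :: l) := rfl

/-- `weight` of a singleton (definitional unfolding). [folklore] -/
@[simp] theorem weight_singleton (u : V) : weight w [u] = 0 := rfl

/-- `weight` of the empty sequence (definitional unfolding). [folklore] -/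
@[simp] theorem weight_nil : weight w ([] : List V) = 0 := rfl

/-- A walk splits at any vertex into two walks sharing that vertex. [folklore] -/
theorem isWalk_append_cons (l₁ : List V) (a : V) (l₂ : List V) :
    IsWalk E (l₁ ++ a :: l₂) ↔ IsWalk E (l₁ ++ [a]) ∧ IsWalk E (a :: l₂) := by
  induction l₁ with
  | nil => simp
  | cons x l₁ ih =>
    cases l₁ with
    | nil =>
      cases l₂ with
      | nil => simp
      | cons y l₂ => simp
    | cons y l₁ =>
      simp only [List.cons_append, isWalk_cons_cons] at ih ⊢
      rw [ih, and_assoc]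

/-- The weight of a walk splits additively at any vertex. [folklore] -/
theorem weight_append_cons (l₁ : List V) (a : V) (l₂ : List V) :
    weight w (l₁ ++ a :: l₂) = weight w (l₁ ++ [a]) + weight w (a :: l₂) := by
  induction l₁ with
  | nil => simp
  | cons x l₁ ih =>
    cases l₁ with
    | nil =>
      cases l₂ with
      | nil => simp
      | cons y l₂ => simp
    | cons y l₁ =>
      simp only [List.cons_append, weight_cons_cons] at ih ⊢
      rw [ih, add_assoc]

/-- Appending one arc to a walk ending at `u`. [folklore] -/
theorem isWalk_append_singleton {l : List V} {u : V} (hl : IsWalk E l) (hu : l.getLast? = some u)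
    {v : V} (huv : E u v) : IsWalk E (l ++ [v]) := by
  obtain ⟨l₀, rfl⟩ := List.getLast?_eq_some_iff.1 hu
  rw [List.append_assoc, List.singleton_append, isWalk_append_cons]
  exact ⟨hl, by simpa using huv⟩

/-- The weight after appending one arc to a walk ending at `u`. [folklore] -/
theorem weight_append_singleton {l : List V} {u : V} (hu : l.getLast? = some u) (v : V) :
    weight w (l ++ [v]) = weight w l + w u v := by
  obtain ⟨l₀, rfl⟩ := List.getLast?_eq_some_iff.1 hu
  rw [List.append_assoc, List.singleton_append, weight_append_cons]
  simp

/-! ### A potential makes every closed walk non-negative -/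

variable {E w}

/-- Telescoping along a walk: `π (last) ≤ π (first) + weight`. [cite: CLRS2009, Thm 24.9 (a negative-weight cycle makes the system infeasible)] -/
theorem IsPotential.apply_getLast_le {π : V → ℝ} (hπ : IsPotential E w π) :
    ∀ (a : V) (l : List V), IsWalk E (a :: l) → ∀ z, (a :: l).getLast? = some z → π z ≤ π a + weight w (a :: l)
  | a, [], _, z, hz => by
    simp only [List.getLast?_singleton, Option.some.injEq] at hz
    subst hz; simp
  | a, b :: l, hw, z, hz => by
    rw [isWalk_cons_cons] at hw
    have ih := IsPotential.apply_getLast_le hπ b l hw.2 z (by simpa using hz)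
    have hab := hπ a b hw.1
    rw [weight_cons_cons]
    linarith

/-- **If a potential exists, every closed walk has non-negative weight.**
[cite: CLRS2009, Thm 24.9 (a negative-weight cycle makes the system infeasible)] -/
theorem weight_nonneg_of_isPotential {π : V → ℝ} (hπ : IsPotential E w π) {l : List V}
    (hl : IsClosedWalk E l) : 0 ≤ weight w l := by
  obtain ⟨hwalk, hlen, hends⟩ := hl
  cases l with
  | nil => simp at hlen
  | cons a l =>
    obtain ⟨z, hz⟩ : ∃ z, (a :: l).getLast? = some z :=
      ⟨_, List.getLast?_eq_some_getLast (List.cons_ne_nil a l)⟩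
    have h := hπ.apply_getLast_le a l hwalk z hz
    have hza : z = a := by
      rw [List.head?_cons, hz, Option.some.injEq] at hends
      exact hends.symm
    rw [hza] at h
    linarith

end Algebra

/-! ### Existence of a potential when short closed walks are non-negative -/

section Existence

variable [Fintype V] {E : V → V → Prop} {w : V → V → ℝ}

/-- The walks with at most `|V|` vertices ending at `v`. [cite: CLRS2009, Lemma 24.2] -/
def shortWalksTo (E : V → V → Prop) (v : V) : Set (List V) :=
  {l | l.length ≤ Fintype.card V ∧ IsWalk E l ∧ l.getLast? = some v}

/-- There are finitely many short walks. [folklore] -/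
theorem shortWalksTo_finite (E : V → V → Prop) (v : V) : (shortWalksTo E v).Finite :=
  (List.finite_length_le V (Fintype.card V)).subset fun _ hl => hl.1

/-- The trivial walk `[v]` is a short walk to `v`. [folklore] -/
theorem singleton_mem_shortWalksTo (E : V → V → Prop) (v : V) : [v] ∈ shortWalksTo E v :=
  ⟨Fintype.card_pos_iff.2 ⟨v⟩, trivial, rfl⟩

/-- Each vertex has a short walk of least weight ending at it. [cite: CLRS2009, Lemma 24.2] -/
theorem exists_min_shortWalk (E : V → V → Prop) (w : V → V → ℝ) (v : V) :
    ∃ l ∈ shortWalksTo E v, ∀ l' ∈ shortWalksTo E v, weight w l ≤ weight w l' := by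
  have hne : (shortWalksTo_finite E v).toFinset.Nonempty :=
    ⟨[v], by simpa using singleton_mem_shortWalksTo E v⟩
  obtain ⟨l, hl, hmin⟩ := Finset.exists_min_image _ (weight w) hne
  exact ⟨l, by simpa using hl, fun l' hl' => hmin l' (by simpa using hl')⟩

/-- A sequence with more than `|V|` vertices repeats a vertex: it splits as
`P ++ a :: M ++ a :: S`. [folklore] -/
theorem exists_split_of_card_lt_length {l : List V} (h : Fintype.card V < l.length) :
    ∃ (P M S : List V) (a : V), l = P ++ a :: M ++ a :: S := by
  have hnd : ¬ l.Nodup := fun hnd => absurd hnd.length_le_card (not_le.2 h)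
  rw [List.nodup_iff_sublist] at hnd
  simp only [not_forall, not_not] at hnd
  obtain ⟨a, ha⟩ := hnd
  rw [show [a, a] = [a] ++ [a] from rfl, List.append_sublist_iff] at ha
  obtain ⟨r₁, r₂, rfl, h₁, h₂⟩ := ha
  rw [List.singleton_sublist] at h₁ h₂
  obtain ⟨s₁, t₁, rfl⟩ := List.append_of_mem h₁
  obtain ⟨s₂, t₂, rfl⟩ := List.append_of_mem h₂
  exact ⟨s₁, t₁ ++ s₂, t₂, a, by simp⟩

/-- **Existence of a potential (Gallai; Bellman–Ford).** On a finite vertex type, if every closed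
walk with at most `|V| + 1` vertices (at most `|V|` arcs) has non-negative weight, then `(E, w)` has
a potential. The potential is `π v =` the least weight of a walk with at most `|V|` vertices ending
at `v`; for an arc `E u v` the optimal walk to `u` extended by the arc either is short, or repeats a
vertex and then splits off a non-negative closed walk of at most `|V|` arcs.
[cite: CLRS2009, Thm 24.9 (no negative-weight cycle: shortest-path weights are a feasible solution) with Lemma 24.2] -/
theorem exists_isPotential
    (h : ∀ l : List V, IsClosedWalk E l → l.length ≤ Fintype.card V + 1 → 0 ≤ weight w l) :
    ∃ π : V → ℝ, IsPotential E w π := by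
  classical
  choose best hbest hmin using exists_min_shortWalk E w
  refine ⟨fun v => weight w (best v), fun u v huv => ?_⟩
  obtain ⟨hlenu, hwalku, hlastu⟩ := hbest u
  -- extend the optimal walk to `u` by the arc `(u, v)`
  set l' : List V := best u ++ [v] with hl'
  have hwalk' : IsWalk E l' := isWalk_append_singleton E hwalku hlastu huv
  have hlast' : l'.getLast? = some v := by simp [hl']
  have hwt' : weight w l' = weight w (best u) + w u v := weight_append_singleton w hlastu v
  have hlen' : l'.length = (best u).length + 1 := by simp [hl']
  by_cases hshort : l'.length ≤ Fintype.card V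
  · -- the extended walk is short
    have := hmin v l' ⟨hshort, hwalk', hlast'⟩
    show weight w (best v) ≤ weight w (best u) + w u v
    rwa [← hwt']
  · -- it repeats a vertex: split off a closed walk and drop it
    have hgt : Fintype.card V < l'.length := not_le.1 hshort
    obtain ⟨P, M, S, a, hsplit⟩ := exists_split_of_card_lt_length hgt
    -- the closed walk `a :: M ++ [a]` and the shortcut `P ++ a :: S`
    have hw1 : IsWalk E (P ++ [a]) ∧ IsWalk E (a :: (M ++ a :: S)) := by
      rw [← isWalk_append_cons]; simpa [hsplit] using hwalk'
    have hw2 : IsWalk E (a :: M ++ [a]) ∧ IsWalk E (a :: S) := by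
      rw [← isWalk_append_cons]; exact hw1.2
    have hclosed : IsClosedWalk E (a :: M ++ [a]) := by
      refine ⟨hw2.1, by simp, ?_⟩
      rw [List.getLast?_append]; rfl
    have hl'len : l'.length = P.length + M.length + S.length + 2 := by
      rw [hsplit]; simp only [List.length_append, List.length_cons]; omega
    have hclen : (a :: M ++ [a]).length ≤ Fintype.card V + 1 := by
      simp only [List.length_cons, List.length_append, List.length_nil]
      omega
    have hC := h _ hclosed hclen
    have hshortcut_walk : IsWalk E (P ++ a :: S) := by
      rw [isWalk_append_cons]; exact ⟨hw1.1, hw2.2⟩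
    have hS : (a :: S).getLast? = some v := by
      have h1 : l'.getLast? = (a :: S).getLast? := by
        rw [hsplit, List.getLast?_append, List.getLast?_eq_some_getLast (List.cons_ne_nil a S)]; rfl
      rw [← h1, hlast']
    have hshortcut_last : (P ++ a :: S).getLast? = some v := by
      rw [List.getLast?_append, hS]; rfl
    have hshortcut_len : (P ++ a :: S).length ≤ Fintype.card V := by
      simp only [List.length_append, List.length_cons]
      omega
    have hshortcut_wt : weight w l' = weight w (P ++ a :: S) + weight w (a :: M ++ [a]) := by
      have e2 : weight w (a :: (M ++ a :: S)) = weight w (a :: M ++ [a]) + weight w (a :: S) :=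
        weight_append_cons w (a :: M) a S
      rw [hsplit, List.append_assoc, List.cons_append, weight_append_cons w P a (M ++ a :: S), e2,
        weight_append_cons w P a S]
      ring
    have hle := hmin v (P ++ a :: S) ⟨hshortcut_len, hshortcut_walk, hshortcut_last⟩
    show weight w (best v) ≤ weight w (best u) + w u v
    rw [← hwt']
    linarith

end Existence

/-! ### Weights as integer combinations of coordinates -/

section Multiplicity

variable {ι : Type*} [DecidableEq ι]

/-- Arc multiplicities of a vertex sequence, pushed to coordinates through an arc labelling `e`:
`mult e l i` is the number of consecutive pairs `(u, v)` of `l` with `e u v = i`. [folklore] -/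
def mult (e : V → V → ι) : List V → ι → ℕ
  | [] => 0
  | [_] => 0
  | u :: v :: l => mult e (v :: l) + Pi.single (e u v) 1

/-- `mult` on `u :: v :: l` (definitional unfolding). [folklore] -/
@[simp] theorem mult_cons_cons (e : V → V → ι) (u v : V) (l : List V) :
    mult e (u :: v :: l) = mult e (v :: l) + Pi.single (e u v) 1 := rfl

/-- Multiplicities are at most the number of arcs (`< |l|`). [folklore] -/
theorem mult_le_length (e : V → V → ι) : ∀ (l : List V) (i : ι), mult e l i ≤ l.length
  | [], i => by simp [mult]
  | [_], i => by simp [mult]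
  | u :: v :: l, i => by
    rw [mult_cons_cons, Pi.add_apply, Pi.single_apply, List.length_cons]
    have := mult_le_length e (v :: l) i
    split_ifs <;> omega

/-- **The weight of a walk for coordinate weights `w u v = x (e u v)` is the integer combination
`∑ᵢ multᵢ · xᵢ` of the coordinates.** [folklore] -/
theorem weight_eq_sum_mult [Fintype ι] (e : V → V → ι) (x : ι → ℝ) :
    ∀ l : List V, weight (fun u v => x (e u v)) l = ∑ i, (mult e l i : ℝ) * x i
  | [] => by simp [mult]
  | [_] => by simp [mult]
  | u :: v :: l => by
    rw [weight_cons_cons, weight_eq_sum_mult e x (v :: l), mult_cons_cons]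
    simp only [Pi.add_apply, Pi.single_apply, Nat.cast_add, Nat.cast_ite, Nat.cast_one, Nat.cast_zero, add_mul,
      Finset.sum_add_distrib, ite_mul, one_mul, zero_mul, Finset.sum_ite_eq', Finset.mem_univ, if_true]
    ring

end Multiplicity

end DifferenceConstraints

end Literature.Combinatorics.Optimization
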